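import Literature.IUT.LogVolume.PadicSubfields
import HarnessLib

/-!
# A tame quadratic `p`-adic field `K = ℚ_p(π)`, `π² = p`: absolute values, coordinates, isometries

Classical local arithmetic (no disputed mathematics; the [IUTchIV] locator records where the abc-iut cell uses it).
Let `K` be a field which is a normed `ℚ_p`-algebra containing `π` with `π² = p` (so, when `[K : ℚ_p] = 2`,
`K = ℚ_p(√p)`: totally and — for `p` odd — TAMELY ramified, `e = 2`, `𝒪_K = ℤ_p[π]`).  We prove

* `norm_combo` / `norm_eq_max` — `‖a·1 + b·π‖ = max(‖a‖, ‖b‖·‖π‖)` (the two summands have distinct absolute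
  values: their squares are an even and an odd power of `p`); `linearIndependent_one_pi`, `exists_basis`;
* `isometry_coeff_bounds` — a `ℚ_p`-linear ISOMETRY `σ` of `K` has `σ 1 = a₁ + b₁π`, `σ π = a₂ + b₂π` with
  `‖a₁‖ ≤ 1`, `‖b₁‖·‖π‖ ≤ 1`, `‖a₂‖ ≤ ‖π‖`, `‖b₂‖ ≤ 1`;
* `exists_subfield` — `ℚ_p(√p) ⊆ ℚ̄_p` exists with `[ℚ_p(√p) : ℚ_p] = 2` (any prime `p`).

Consumed by `TameQuadraticIsometryStable.lean` (factorwise isometries FIX the maximal order `(R_I)^∼` of the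
two-factor packet `K ⊗_{ℚ_p} K` for `p` odd — the tame counterpart of `WildCubicIsometryMover.lean`).
Proof-only file (theorems, no definitions). [cite: NeukirchANT1999, Ch. II (5.5)]
[cite: Mochizuki2012, IUTchIV Prop. 1.1 p. 9]
-/

noncomputable section

open Metric Set

namespace Literature.IUT.LogVolume

namespace TameQuadratic

variable {p : ℕ} [Fact p.Prime]
variable {K : Type*} [NontriviallyNormedField K] [NormedAlgebra ℚ_[p] K] {π : K}

/-! ### Absolute values of `p`, `2`, `π`, and of `ℚ_p`-multiples of `1, π` -/

/-- `‖(m : K)‖ = ‖(m : ℚ_p)‖` for a natural number `m`. [cite: NeukirchANT1999, Ch. II (5.5)] -/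
theorem norm_natCast (p : ℕ) [Fact p.Prime] [NormedAlgebra ℚ_[p] K] (m : ℕ) : ‖(m : K)‖ = ‖(m : ℚ_[p])‖ := by
  rw [← map_natCast (algebraMap ℚ_[p] K) m, norm_algebraMap' K (m : ℚ_[p])]

/-- `‖p‖ = 1/p` in `K`. [cite: NeukirchANT1999, Ch. II (5.5)] -/
theorem norm_p (p : ℕ) [Fact p.Prime] [NormedAlgebra ℚ_[p] K] : ‖(p : K)‖ = (p : ℝ)⁻¹ := by
  rw [norm_natCast p]
  exact Padic.norm_p

/-- `‖π‖² = 1/p`. [cite: NeukirchANT1999, Ch. II (5.5)] -/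
theorem norm_pi_sq (hπ : π ^ 2 = (p : K)) : ‖π‖ ^ 2 = (p : ℝ)⁻¹ := by
  rw [← norm_pow, hπ, norm_p p]

/-- `π ≠ 0`. [cite: NeukirchANT1999, Ch. II (5.5)] -/
theorem pi_ne_zero (hπ : π ^ 2 = (p : K)) : π ≠ 0 := by
  intro h
  have h1 : ‖π‖ ^ 2 = (p : ℝ)⁻¹ := norm_pi_sq hπ
  rw [h, norm_zero, zero_pow two_ne_zero] at h1
  have hp : (0 : ℝ) < (p : ℝ)⁻¹ := by
    have : (0 : ℝ) < p := by exact_mod_cast (Fact.out : p.Prime).pos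
    positivity
  exact absurd h1 (ne_of_lt hp)

/-- `0 < ‖π‖`. [cite: NeukirchANT1999, Ch. II (5.5)] -/
theorem norm_pi_pos (hπ : π ^ 2 = (p : K)) : 0 < ‖π‖ := norm_pos_iff.mpr (pi_ne_zero hπ)

/-- `‖π‖ < 1`. [cite: NeukirchANT1999, Ch. II (5.5)] -/
theorem norm_pi_lt_one (hπ : π ^ 2 = (p : K)) : ‖π‖ < 1 := by
  have h1 : ‖π‖ ^ 2 < 1 := by
    rw [norm_pi_sq hπ]
    have : (1 : ℝ) < p := by exact_mod_cast (Fact.out : p.Prime).one_lt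
    exact inv_lt_one_of_one_lt₀ this
  exact (pow_lt_one_iff_of_nonneg (norm_nonneg _) two_ne_zero).mp h1

/-- For `p` odd, `‖2‖ = 1` in `K`. [cite: NeukirchANT1999, Ch. II (5.5)] -/
theorem norm_two (p : ℕ) [Fact p.Prime] [NormedAlgebra ℚ_[p] K] (hp : p ≠ 2) : ‖(2 : K)‖ = 1 := by
  have h : ‖((2 : ℕ) : K)‖ = 1 := by
    rw [norm_natCast p, Padic.norm_natCast_eq_one_iff]
    exact (Nat.coprime_primes (Fact.out : p.Prime) Nat.prime_two).mpr hp
  simpa using h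

/-- `‖a • 1‖ = ‖a‖` for `a ∈ ℚ_p`. [cite: NeukirchANT1999, Ch. II (5.5)] -/
theorem norm_smul_one (a : ℚ_[p]) : ‖a • (1 : K)‖ = ‖a‖ := by
  rw [norm_smul, norm_one, mul_one]

/-- The absolute values `‖a‖` and `‖b‖·‖π‖` (`a, b ∈ ℚ_p^×`) are DISTINCT: their squares are an even and an odd
power of `p`. [cite: NeukirchANT1999, Ch. II (5.5)] -/
theorem norm_ne_norm_mul_norm_pi (hπ : π ^ 2 = (p : K)) {a b : ℚ_[p]} (ha : a ≠ 0) (hb : b ≠ 0) :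
    ‖a‖ ≠ ‖b‖ * ‖π‖ := by
  intro h
  have hp0 : (0 : ℝ) < p := by exact_mod_cast (Fact.out : p.Prime).pos
  have hp1 : (p : ℝ) ≠ 1 := by exact_mod_cast (Fact.out : p.Prime).one_lt.ne'
  have h2 : ‖a‖ ^ 2 = (‖b‖ * ‖π‖) ^ 2 := by rw [h]
  rw [mul_pow, norm_pi_sq hπ, Padic.norm_eq_zpow_neg_valuation ha, Padic.norm_eq_zpow_neg_valuation hb,
    ← zpow_natCast, ← zpow_natCast, ← zpow_mul, ← zpow_mul, ← zpow_neg_one, ← zpow_add₀ hp0.ne'] at h2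
  have hinj := zpow_right_injective₀ hp0 hp1 h2
  push_cast at hinj
  omega

/-- **`‖a·1 + b·π‖ = max(‖a‖, ‖b‖·‖π‖)`** (`a, b ∈ ℚ_p`). [cite: NeukirchANT1999, Ch. II (5.5)] -/
theorem norm_combo [IsUltrametricDist K] (hπ : π ^ 2 = (p : K)) (a b : ℚ_[p]) :
    ‖a • (1 : K) + b • π‖ = max ‖a‖ (‖b‖ * ‖π‖) := by
  rw [← norm_smul_one (K := K) a, ← norm_smul b π]
  by_cases ha : a = 0
  · rw [ha, zero_smul, zero_add, norm_zero, max_eq_right (norm_nonneg _)]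
  by_cases hb : b = 0
  · rw [hb, zero_smul, add_zero, norm_zero, max_eq_left (norm_nonneg _)]
  apply IsUltrametricDist.norm_add_eq_max_of_norm_ne_norm
  rw [norm_smul_one, norm_smul]
  exact norm_ne_norm_mul_norm_pi hπ ha hb

/-- `1, π` are `ℚ_p`-linearly independent (`π ∉ ℚ_p` as `‖π‖ = p^{−1/2}`). [cite: NeukirchANT1999, Ch. II (5.5)] -/
theorem linearIndependent_one_pi [IsUltrametricDist K] (hπ : π ^ 2 = (p : K)) :
    LinearIndependent ℚ_[p] ![(1 : K), π] := by
  refine LinearIndependent.pair_iff.mpr fun s t hst => ?_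
  have h : max ‖s‖ (‖t‖ * ‖π‖) = 0 := by rw [← norm_combo hπ, hst, norm_zero]
  have hs : ‖s‖ = 0 := le_antisymm ((le_max_left _ _).trans_eq h) (norm_nonneg _)
  have ht : ‖t‖ * ‖π‖ = 0 :=
    le_antisymm ((le_max_right _ _).trans_eq h) (mul_nonneg (norm_nonneg _) (norm_nonneg _))
  refine ⟨norm_eq_zero.mp hs, ?_⟩
  rcases mul_eq_zero.mp ht with ht | ht
  · exact norm_eq_zero.mp ht
  · exact absurd ht (norm_pi_pos hπ).ne'

/-- A `ℚ_p`-basis `(1, π)` of `K` when `[K : ℚ_p] = 2`. [cite: NeukirchANT1999, Ch. II (5.5)] -/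
theorem exists_basis [IsUltrametricDist K] (hK : Module.finrank ℚ_[p] K = 2) (hπ : π ^ 2 = (p : K)) :
    ∃ B : Module.Basis (Fin 2) ℚ_[p] K, B 0 = 1 ∧ B 1 = π := by
  have hli := linearIndependent_one_pi hπ
  let B := basisOfLinearIndependentOfCardEqFinrank hli (by rw [hK, Fintype.card_fin])
  have hB : ⇑B = ![(1 : K), π] := coe_basisOfLinearIndependentOfCardEqFinrank _ _
  exact ⟨B, by rw [hB]; rfl, by rw [hB]; rfl⟩

/-! ### Coordinates with respect to the basis `(1, π)` -/

section Basis

variable (B : Module.Basis (Fin 2) ℚ_[p] K)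

/-- Coordinates: `x₀·1 + x₁·π = x`. [cite: NeukirchANT1999, Ch. II (5.5)] -/
theorem combo_repr (hB0 : B 0 = 1) (hB1 : B 1 = π) (x : K) : B.repr x 0 • (1 : K) + B.repr x 1 • π = x := by
  conv_rhs => rw [← B.sum_repr x]
  rw [Fin.sum_univ_two, hB0, hB1]

/-- `‖x‖ = max(‖x₀‖, ‖x₁‖·‖π‖)`. [cite: NeukirchANT1999, Ch. II (5.5)] -/
theorem norm_eq_max [IsUltrametricDist K] (hπ : π ^ 2 = (p : K)) (hB0 : B 0 = 1) (hB1 : B 1 = π) (x : K) :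
    ‖x‖ = max ‖B.repr x 0‖ (‖B.repr x 1‖ * ‖π‖) := by
  conv_lhs => rw [← combo_repr B hB0 hB1 x]
  exact norm_combo hπ _ _

/-- Coordinates of `1` and `π`: `1₀ = 1`, `1₁ = 0`, `π₀ = 0`, `π₁ = 1`. [cite: NeukirchANT1999, Ch. II (5.5)] -/
theorem repr_one_pi (hB0 : B 0 = 1) (hB1 : B 1 = π) :
    B.repr 1 0 = 1 ∧ B.repr 1 1 = 0 ∧ B.repr π 0 = 0 ∧ B.repr π 1 = 1 := by
  refine ⟨?_, ?_, ?_, ?_⟩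
  · rw [← hB0, B.repr_self]; simp
  · rw [← hB0, B.repr_self]; simp
  · rw [← hB1, B.repr_self]; simp
  · rw [← hB1, B.repr_self]; simp

/-- **Coefficients of an ISOMETRY** `σ` (`‖σ x‖ = ‖x‖` for all `x`): `σ 1 = a₁ + b₁π`, `σ π = a₂ + b₂π` with
`‖a₁‖ ≤ 1`, `‖b₁‖·‖π‖ ≤ 1`, `‖a₂‖ ≤ ‖π‖`, `‖b₂‖ ≤ 1` (read off `‖σ 1‖ = 1`, `‖σ π‖ = ‖π‖` by `norm_eq_max`).
[cite: NeukirchANT1999, Ch. II (5.5)] -/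
theorem isometry_coeff_bounds [IsUltrametricDist K] (hπ : π ^ 2 = (p : K)) (hB0 : B 0 = 1) (hB1 : B 1 = π)
    (σ : K ≃ₗ[ℚ_[p]] K) (hσ : ∀ x, ‖σ x‖ = ‖x‖) :
    ‖B.repr (σ 1) 0‖ ≤ 1 ∧ ‖B.repr (σ 1) 1‖ * ‖π‖ ≤ 1 ∧ ‖B.repr (σ π) 0‖ ≤ ‖π‖ ∧ ‖B.repr (σ π) 1‖ ≤ 1 := by
  have h1 : max ‖B.repr (σ 1) 0‖ (‖B.repr (σ 1) 1‖ * ‖π‖) = 1 := by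
    rw [← norm_eq_max B hπ hB0 hB1, hσ, norm_one]
  have h2 : max ‖B.repr (σ π) 0‖ (‖B.repr (σ π) 1‖ * ‖π‖) = ‖π‖ := by
    rw [← norm_eq_max B hπ hB0 hB1, hσ]
  refine ⟨(le_max_left _ _).trans_eq h1, (le_max_right _ _).trans_eq h1, (le_max_left _ _).trans_eq h2, ?_⟩
  have h3 : ‖B.repr (σ π) 1‖ * ‖π‖ ≤ 1 * ‖π‖ := by rw [one_mul]; exact (le_max_right _ _).trans_eq h2
  exact le_of_mul_le_mul_right h3 (norm_pi_pos hπ)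

end Basis

end TameQuadratic

/-! ## Non-vacuity: `ℚ_p(√p) ⊆ ℚ̄_p` -/

open Polynomial IntermediateField in
/-- **A tame quadratic subfield of `ℚ̄_p`**: there are `E ⊆ ℚ̄_p` with `[E : ℚ_p] = 2` and `π ∈ E`, `π² = p`
(any prime `p`; `E = ℚ_p(√p)`). [cite: NeukirchANT1999, Ch. II (5.5)] -/
theorem TameQuadratic.exists_subfield (p : ℕ) [Fact p.Prime] :
    ∃ (E : IntermediateField ℚ_[p] (PadicAlgCl p)) (π : E), FiniteDimensional ℚ_[p] E ∧
      Module.finrank ℚ_[p] E = 2 ∧ π ^ 2 = (p : E) := by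
  obtain ⟨α, hα⟩ := IsAlgClosed.exists_pow_nat_eq (p : PadicAlgCl p) (by norm_num : 0 < 2)
  have hp' : algebraMap ℚ_[p] (PadicAlgCl p) (p : ℚ_[p]) = (p : PadicAlgCl p) := map_natCast _ p
  have heval : Polynomial.aeval α (X ^ 2 - C (p : ℚ_[p])) = 0 := by
    rw [map_sub, aeval_X_pow, aeval_C, hp', hα, sub_self]
  have hint : IsIntegral ℚ_[p] α := ⟨X ^ 2 - C (p : ℚ_[p]), monic_X_pow_sub_C _ (by norm_num), by
    simpa [Polynomial.aeval_def] using heval⟩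
  haveI hfd : FiniteDimensional ℚ_[p] ℚ_[p]⟮α⟯ := adjoin.finiteDimensional hint
  have hπE : (⟨α, mem_adjoin_simple_self ℚ_[p] α⟩ : ℚ_[p]⟮α⟯) ^ 2 = (p : ℚ_[p]⟮α⟯) := by
    apply Subtype.ext
    have hpE : ((p : ℚ_[p]⟮α⟯) : PadicAlgCl p) = p := map_natCast (algebraMap ℚ_[p]⟮α⟯ (PadicAlgCl p)) p
    rw [hpE, ← hα]
    rfl
  refine ⟨ℚ_[p]⟮α⟯, ⟨α, mem_adjoin_simple_self ℚ_[p] α⟩, hfd, le_antisymm ?_ ?_, hπE⟩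
  · rw [adjoin.finrank hint]
    have hdvd : minpoly ℚ_[p] α ∣ X ^ 2 - C (p : ℚ_[p]) := minpoly.dvd ℚ_[p] α heval
    have hne : (X ^ 2 - C (p : ℚ_[p])) ≠ 0 := (monic_X_pow_sub_C _ (by norm_num)).ne_zero
    calc (minpoly ℚ_[p] α).natDegree ≤ (X ^ 2 - C (p : ℚ_[p])).natDegree := natDegree_le_of_dvd hdvd hne
      _ = 2 := natDegree_X_pow_sub_C
  · have hli := TameQuadratic.linearIndependent_one_pi (K := ℚ_[p]⟮α⟯) hπE
    simpa using hli.fintype_card_le_finrank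

end Literature.IUT.LogVolume

end
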